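import Summits.MatrixMultiplication.MatrixMultiplication.Theses.SnSubsetDichotomy
import Literature.Barriers.MatrixMultiplication.YoungSubgroupBarrier
import Literature.Barriers.MatrixMultiplication.QuasirandomBarrierSTPP
import Literature.Combinatorics.Additive.TPPGroupAlgebra
import Summits.MatrixMultiplication.MatrixMultiplication.Theorems.SnSubsetDichotomyGlobalBranchStubTruncatedCount
import Summits.MatrixMultiplication.MatrixMultiplication.Theorems.SnSubsetDichotomyGlobalBranchStubDimGrowth
import Summits.MatrixMultiplication.MatrixMultiplication.Theorems.SnSubsetDichotomyGlobalBranchIncoherentCase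
import Summits.MatrixMultiplication.MatrixMultiplication.Theorems.SnSubsetDichotomyGlobalBranchStubHostedPairCount
import Summits.MatrixMultiplication.MatrixMultiplication.Theorems.SnSubsetDichotomyGlobalBranchStubUrnBound
import Summits.MatrixMultiplication.MatrixMultiplication.Theorems.SnSubsetDichotomyGlobalBranchStubSqueezeInduction

/-!
# Line `young-host-squeeze` for crux `GlobalBranch` (stmt-MatrixMultiplication-8303) — LEAD'S SKELETON (seat 1, v3: all provable stubs LANDED and imported; the only sorry is the residual)

Reshaped by the line lead from the planner's `Lines/young_host_squeeze.lean` (see `PICKED.md`):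
* the squeeze is proved for fineness caps `1/2 ≤ θ < 2/3` (crude Poissonisation of the row-by-row
  hypergeometric factorisation suffices there; `κ = 1/32`), and `stub_multinomialSqueeze` is SPLIT into
  `stub_urnBound` (analytic: one-row multivariate-hypergeometric anti-concentration, pure `ℕ/ℝ`) and
  `stub_squeezeInduction` (combinatorial: row peeling + generalised Vandermonde over sub-`Finset`s of
  `Fin n`, the urn bound taken as a hypothesis), assembled WITHOUT sorry below (`multinomialSqueeze`);
* the residual's cap range follows (`θ < 2/3`);
* v2: the residual is INTERSECTED with the complement of the incoherent case — the LANDED truncated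
  count + dimension growth of the line `flat-tail-truncation` (`Theorems.GlobalBranch.stub_truncatedCount`,
  `stub_dimGrowth`, seat 0) prove here, sorry-free, `incoherent_subthreshold`: every TPP triple whose
  low-level coherence weight `lowWeight ⌊√n⌋ S T U = Σ_{ℓ ≤ √n} n^{(ℓ)}(sM_ℓ(S)sM_ℓ(T)sM_ℓ(U) + twisted)`
  is `≤ 1/2` is sub-threshold (no flatness of individual sets needed); so the named residue
  `stub_coherentEvasiveResidual` is the crux on triples that are bump-free AND have two
  fine-Young-evasive sets AND are spectrally COHERENT (`lowWeight > 1/2`) — the joint residue of both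
  pre-filters; `GlobalBranch_of : GlobalBranch` is proved from the four stubs `stub_hostedPairCount`,
  `stub_urnBound`, `stub_squeezeInduction`, `stub_coherentEvasiveResidual`.

Skeleton (crux-plan, round 1).  Idea card: `Cruxes/GlobalBranch/Ideas/young-host-squeeze.md`;
triage `TRIAGE-r1-{1,2,3}.md` (pass ×3, merged with `frustration-packing-tradeoff` (a)).

THE LEVER.  If `A ⊆ S` sits in the Young coset `a·Y_f·b` and `B ⊆ T` in `a'·Y_g·b'`, then the
quotient map `(s,t) ↦ s⁻¹t`, injective by the pairwise part of the TPP, lands in the double coset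
`b⁻¹ (Y_f · x · Y_g) b'`, `x = a⁻¹a'`, so
`|S ∩ aY_fb| · |T ∩ a'Y_gb'| ≤ |Y_f x Y_g| = |Y_f|·|xY_gx⁻¹| / |Y_f ∩ xY_gx⁻¹| = ∏ bᵢ! ∏ cⱼ! / ∏ e_q!`
(rows `bᵢ` = blocks of `f`, columns `cⱼ` = blocks of `g ∘ x⁻¹`, cells `e_q` = blocks of their
meet) — `stub_hostedPairCount`.  THE SQUEEZE: when all blocks are FINE (`≤ n^θ`,
`1/2 ≤ θ < 3/4`) the modal probability `∏bᵢ!∏cⱼ!/(n!∏e_q!)` that a random `g`-partition meets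
the `f`-partition in a prescribed cell pattern is `≤ exp(-κ n^{2-2θ})` (row-by-row hypergeometric
anti-concentration = per-cell Stirling defect; numerics below and triage r1-1/2/3: `-0.51 n` at
blocks `1.65√n`, n = 10065) — `stub_multinomialSqueeze`.  Since `2 - 2θ > 1/2`, two sets of a
TPP triple that are both CAPTURED to a fraction `> exp(-(κ/4)n^{2-2θ})` by fine Young cosets
force `|S||T| ≤ n!·exp(-(κ/2)n^{2-2θ})`, and with the two packing bounds through the third set the
triple is sub-threshold with `c = κ/4` (`pair_subthreshold`, `twoCaptured_subthreshold`, PROVED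
here from stubs 1+2).  By pigeonhole on three sets, what is left is the class of bump-free TPP
triples in which AT LEAST TWO sets are fine-Young-EVASIVE (every coset of a Young subgroup with
blocks `≤ n^θ` captures at most an `exp(-κ' n^{2-2θ})` fraction) — `stub_evasiveResidual`, the
crux restricted to that class, with the bump exponent `ε` and the fineness cap `θ` both at the
prover's disposal: the honest residue named by all three triagers (B(M)-hosted, transversal-like,
random-like sets and giant-block hosts with blocks `≥ n^{3/4}` are evasive; every configuration
hosted by two Young cosets with blocks `< n^{3/4-η}` is gone).  `GlobalBranch_of` assembles the
three stubs into the crux BY NAME (kernel-checked, no sorry outside `stub_*`).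

Corrections to the card (triage r1-2/r1-3 "sharpen", acted on): (i) the card's exponent
`e^{-c n^{1/2-2ε}}` is NOT sub-threshold (`n^{1/2-2ε} < √n`); the true row-by-row rate for cap
`n^{1/2+ε}` is `n^{1-2ε}` (indeed `·log n`), and for a general cap `n^θ` it is `n^{2-2θ}`, which
beats `√n` exactly for `θ < 3/4` — the squeeze range observed numerically by the triage ("dead up to
b ≈ n^{3/4}/polylog"); (ii) the LOCAL form (any two fine cosets, any two of the three sets) is what
the glue consumes; (iii) unequal shapes `f ≠ g` and arbitrary relative position are built in; (iv)
frustration-packing-tradeoff (a) is the same stub 1.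

Numerics for stub 2 (this session, `checks/check_stub2*.py`, exact lgamma, worst profile = all
blocks at the cap, cells most spread): `log(∏b!∏c!/(n!∏e!)) / n^{2-2θ}` = −0.89 (θ=.5, n=10³) …
−0.99 (10⁷); θ=.625: −1.48 (10³) … −2.91 (10⁷); θ=.74: −1.69 (10³) … −4.67 (10⁷) — negative,
decreasing in n, so κ = 0.8, n₁ = 10³ fit every probed (θ, n); finer or uneven column profiles only
lower the ratio (singleton columns: −10 to −77 per n^{2-2θ}).  Stub 1 brute-forced in S₃–S₅
(`checks/check_stub1.py`: 3554 random PairTPP instances, 0 violations; 260 whole-coset × greedy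
instances all attain EQUALITY — the count is tight).

Disproof used (`Cruxes/GlobalBranch/Disproof.lean` v5, published 2026-08-16T04:11Z — §1–§4 re-derived
and importable by name; cycle-1 v4 theorems (A) `not_globalBranchSuperExp`, (B)
`not_pairwiseGlobalBranch` recorded there, to be re-landed under `Negative/`; none landed yet, so no
Negative lemma could be imported into this check): honours `globalBranch_false_without_TPP`
(the TPP enters through the pairwise injectivity in `stub_hostedPairCount`, the packing bounds
`tpp_card_mul_card_le_three`, and is handed whole to `stub_evasiveResidual`); consistent with
`not_pairwiseGlobalBranch` (its tight pair `(Y_a, T_a)` has `T_a` fine-Young-evasive, and no stub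
asserts a pairwise saving for evasive sets — stub 1 is even attained with equality); kills the
inhabitant family of `planarYoung_tpp` / `hex_volume_step` / `not_globalBranchSuperExp` (all three
sets fine-hosted, blocks `≍ √n`) with margin `exp(-Ω(n))`, consistent with their proved `e^{-O(n)}`
volume; claims only `e^{-c√n}` (no `e^{-Cn} ∀C`, refuted by `not_globalBranchSuperExp`); respects
`globalBranchAt_iff_of_half_le` / `globalBranch_iff_small_eps` (the residual may take any small
`ε`; content needs `ε < 1/2`), `globalBranchWithoutInjectivity_trivial` (the bump hypothesis is
copied verbatim with BOTH injectivity clauses, so the residual class stays inhabited) and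
`descFactorial_le_of_bumpFree` / cycle-1 `card_gt_of_threshold` (captures are fractions of large
sets).  The v5 "blind spots of the hypothesis" (setwise-stabiliser cosets `{u : u(B) = L}`,
`S_{n/2} × S_{n/2}` hosts, thick half-block Bohr sets, `B_m`) are all COARSE or non-Young hosts: they
sit inside the residual class (fine-Young-evasive), which is where this line confines the crux.
-/

set_option linter.unusedVariables false
set_option linter.dupNamespace false

open scoped BigOperators Classical
open Finset

namespace Summit.MatrixMultiplication.MatrixMultiplication.Cruxes.GlobalBranch.YoungHostSqueeze

open Literature.Combinatorics.Additive Literature.Barriers.MatrixMultiplication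
open Summit.MatrixMultiplication.MatrixMultiplication.Theses.SnSubsetDichotomy
open Literature.NumberTheory.DiophantineGeometry (numStandardTableaux spechtCharacter)

noncomputable section

/-! ## Stub 1 — counted pair packing in a Young double coset (size M) -/

/-- **Hosted pair count** (card `HostedPairBound` + `DoubleCosetCard`, = frustration-packing (a)
`CosetPairPacking`, counted).  For `A, B ⊆ S_n` with the pairwise part of the TPP
(`s s'⁻¹ t t'⁻¹ = 1 ⇒ s = s', t = t'`, i.e. `(s,t) ↦ s⁻¹t` injective), two labellings
`f g : Fin n → ℕ` and coset parameters `a b a' b'`: the parts `A ∩ a·Y_f·b`, `B ∩ a'·Y_g·b'`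
satisfy `|A ∩ aY_fb| · |B ∩ a'Y_gb'| · ∏_cells e_q! ≤ ∏_rows bᵢ! · ∏_cols cⱼ!`, where rows are
the blocks of `f`, columns the blocks of `g ∘ (a'⁻¹a)` (i.e. of the conjugate `x Y_g x⁻¹`,
`x = a⁻¹a'`) and cells the blocks of the pair labelling.  Proof: the image of `(s,t) ↦ s⁻¹t`
lies in `b⁻¹ (Y_f x Y_g) b'`; `|Y_f x Y_g| · |Y_f ∩ xY_gx⁻¹| = |Y_f| · |xY_gx⁻¹|` (fibres of
`(y,y') ↦ y x y'`); `xY_gx⁻¹ = Y_{g∘x⁻¹}`, `Y_f ∩ Y_{g'} = Y_{(f,g')}`, and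
`|Y_h| = ∏_{i ∈ im h} |h⁻¹(i)|!` (Mathlib `DomMulAct.stabilizer_card`).  Only inequalities are
needed: `cA·cB·|Y_f ∩ Y_{g'}| ≤ |Y_f|·|Y_{g'}|` (injectivity + fibres), `|Y_h| ≤ ∏ blocks!` (tree
`card_youngSubgroup_le`, stated in exactly this product shape) and `∏ cells! ≤ |Y_{(f,g')}|`
(the product of the symmetric groups of the cells embeds).  Tight: attained with equality by
`A = aY_fb` and `B` a greedy transversal (260/260 cases in S₄, S₅).  Why it might fail: it cannot
(finite double counting; brute-forced in S₃–S₅, 0/3554 violations); the risk is only Lean size (M).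
[BCCGU17 arXiv:1712.02302 §4 (Young subgroups, double cosets); CohnUmans2003 Def. 2.1;
tree `Literature.Barriers.MatrixMultiplication.card_youngSubgroup_le`; Mathlib `Doset`,
`DomMulAct.stabilizer_card`] -/
-- LANDED p96910: Theorems/SnSubsetDichotomyGlobalBranchStubHostedPairCount.lean (`Theorems.GlobalBranch.stub_hostedPairCount`).
theorem stub_hostedPairCount {n : ℕ} (A B : Finset (Equiv.Perm (Fin n))) (f g : Fin n → ℕ)
    (a b a' b' : Equiv.Perm (Fin n))
    (hAB : ∀ s ∈ A, ∀ s' ∈ A, ∀ t ∈ B, ∀ t' ∈ B, s * s'⁻¹ * (t * t'⁻¹) = 1 → s = s' ∧ t = t') :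
    (A.filter (fun s => a⁻¹ * s * b⁻¹ ∈ youngSubgroup f)).card *
        (B.filter (fun t => a'⁻¹ * t * b'⁻¹ ∈ youngSubgroup g)).card *
        ∏ q ∈ univ.image (fun p => (f p, g ((a'⁻¹ * a) p))),
          ((univ.filter (fun p => (f p, g ((a'⁻¹ * a) p)) = q)).card).factorial ≤
      (∏ i ∈ univ.image f, ((univ.filter (fun p => f p = i)).card).factorial) *
        ∏ j ∈ univ.image (fun p => g ((a'⁻¹ * a) p)),
          ((univ.filter (fun p => g ((a'⁻¹ * a) p) = j)).card).factorial :=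
  Summit.MatrixMultiplication.MatrixMultiplication.Theorems.GlobalBranch.stub_hostedPairCount A B f g a b
    a' b' hAB

/-! ## Stub 2 — the squeeze, split by the lead into an analytic urn bound (2a) and a combinatorial
row-peeling induction (2b); the squeeze itself (`multinomialSqueeze`) is assembled below without sorry -/

/-- **STUB 2a — one-row urn bound** (multivariate-hypergeometric anti-concentration; pure `ℕ/ℝ`,
size M/L).  Fix `1/2 ≤ θ < 2/3`.  For `n ≥ n₁(θ)`: an urn of `N` balls, `n/2 ≤ N ≤ n`, split into
colour classes `c_j ≤ n^θ` (`j ∈ J`, `Σ c_j = N`), and a prescribed histogram `e_j` (`Σ e_j = b`,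
`b ≤ n^θ`): the number of `b`-subsets realising the histogram, `∏_j C(c_j, e_j)`, is at most
`exp(-b·n^{1-2θ}/16)·C(N, b)`.  PROOF ROUTE (lead's notes, all constants checked): WLOG `e_j ≤ c_j`
and `b ≥ 1`; put `M := N + 1 - b ≥ n/4`.  `C(c_j,e_j) ≤ c_j^{e_j}/e_j!` (`Nat.choose_le_pow_div`) and
`M^b/b! ≤ C(N,b)` (`Nat.pow_le_choose`) give `LHS/C(N,b) ≤ (∏_j c_j^{e_j}/e_j!)·b!/M^b =: Q`.
SMALL ROWS `b ≤ n^{1-θ}/8`: `Q ≤ (n^θ)^b b^b/M^b ≤ (4 b n^{θ-1})^b ≤ 2^{-b} ≤ e^{-b n^{1-2θ}/16}`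
(`b! ≤ b^b`, `log 2 ≥ 1/16 ≥ n^{1-2θ}/16`).  LARGE ROWS `b > n^{1-θ}/8`: with `ν_j := b c_j/M`
(`Σ ν_j = bN/M`), `Q = (b!/b^b)·e^{Σν_j}·∏_j Po(ν_j; e_j)`, `Po(ν;k) = e^{-ν}ν^k/k!`;
`max_k Po(ν;k) ≤ exp(-(9/10)·min(ν,1))` (k = 0: `e^{-ν}`; k ≥ 1: `k! ≥ √(2πk)(k/e)^k`
(`Stirling.le_factorial_stirling`) and `log x ≤ x - 1` give `Po ≤ 1/√(2π) ≤ e^{-9/10}`);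
`Σ_j min(ν_j,1) ≥ (Σ_j ν_j)/max(1, max_j ν_j) ≥ b/(4n^{2θ-1}) = b n^{1-2θ}/4` (`ν_j ≤ n^{2θ}/(n/4)`);
`b!/b^b ≤ e√b·e^{-b}` (`Stirling.stirlingSeq'_antitone`, `stirlingSeq_one`); hence
`log Q ≤ 1 + ½log b + b(b-1)/M - (9/40) b n^{1-2θ}` with `b(b-1)/M ≤ 4 b n^{θ-1} ≤ b n^{1-2θ}/32`
(`n^{2-3θ} ≥ 128`) and `1 + ½ log b ≤ log n ≤ n^{2-3θ}/256 ≤ b n^{1-2θ}/32`; so `log Q ≤ -b n^{1-2θ}/16`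
with room.  `n₁(θ)`: `n ≥ 64` (so `n^θ ≤ n/4`) and `n^{2-3θ} ≥ 256 log n` (exists since `θ < 2/3`).
Why it might fail: it cannot for `θ < 2/3` (margins above); at `θ ≥ 2/3` the crude `b(b-1)/M` term
(with/without replacement) is no longer lower order — the reason for the lead's cap.
[Robbins 1955 / Mathlib `Stirling.le_factorial_stirling`, `Stirling.stirlingSeq'_antitone`;
`Nat.choose_le_pow_div`, `Nat.pow_le_choose`] -/
-- LANDED (wave 1): Theorems/SnSubsetDichotomyGlobalBranchStubUrnBound.lean (`Theorems.GlobalBranch.stub_urnBound`).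
theorem stub_urnBound : ∀ θ : ℝ, 1 / 2 ≤ θ → θ < 2 / 3 → ∃ n₁ : ℕ, ∀ n : ℕ, n₁ ≤ n →
    ∀ (J : Finset ℕ) (c e : ℕ → ℕ) (N b : ℕ), (n : ℝ) / 2 ≤ (N : ℝ) → N ≤ n →
    (∑ j ∈ J, c j) = N → (∑ j ∈ J, e j) = b → ((b : ℕ) : ℝ) ≤ (n : ℝ) ^ θ →
    (∀ j ∈ J, ((c j : ℕ) : ℝ) ≤ (n : ℝ) ^ θ) →
    ((∏ j ∈ J, (c j).choose (e j) : ℕ) : ℝ) ≤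
      Real.exp (-((n : ℝ) ^ (1 - 2 * θ) / 16 * (b : ℝ))) * ((N.choose b : ℕ) : ℝ) :=
  Summit.MatrixMultiplication.MatrixMultiplication.Theorems.GlobalBranch.stub_urnBound

/-- **STUB 2b — the squeeze by row peeling** (combinatorial, size L).  For a cap `B`, a threshold
`m ≥ 0` and a rate `κ₁ ≥ 0` such that every urn with `m ≤ N ≤ n` balls, classes `≤ B` and `b ≤ B`
draws satisfies the one-row bound `∏_j C(c_j,e_j) ≤ e^{-κ₁ b} C(N,b)` (hypothesis `hU`, = stub 2a
at `B = n^θ`, `m = n/2`, `κ₁ = n^{1-2θ}/16`): for every `s ⊆ Fin n` and labellings `f g` whose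
blocks INSIDE `s` have size `≤ B`,
`(∏_rows bᵢ!)(∏_cols cⱼ!)·exp(κ₁(|s| - m)) ≤ |s|!·∏_cells e_q!` (rows = fibres of `f` in `s`,
columns = fibres of `g` in `s`, cells = fibres of `(f,g)` in `s`).  PROOF ROUTE (lead's notes):
strong induction on `|s|`.  `s = ∅`: `1·1·e^{-κ₁ m} ≤ 1`.  Otherwise pick a row `i₀ ∈ s.image f`,
`R := s.filter (f = i₀)` (`b := |R| ≤ B`), `s' := s.filter (f ≠ i₀)`, `J := s.image g`,
`c_j := |s ∩ g⁻¹j|`, `e_j := |R ∩ g⁻¹j|`, `c'_j := |s' ∩ g⁻¹j| = c_j - e_j`; then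
`rows(s) = b!·rows(s')`, `cols(s) = ∏_J c_j!`, `cols(s') = ∏_J c'_j!` (classes absent from `s'`
contribute `0! = 1`), `cells(s) = (∏_J e_j!)·cells(s')`, `|s| = b + |s'|`,
`Σ_J c_j = |s|`, `Σ_J e_j = b` (`Finset.card_eq_sum_card_fiberwise`).  The peeled factor is
`F := C(|s|, b)/∏_J C(c_j, e_j)`, i.e. `∏_J c_j!·b!·|s'|! · (1/F) = |s|!·∏_J e_j!·∏_J c'_j!`.
ALWAYS `F ≥ 1` (generalised Vandermonde `∏_J C(c_j,e_j) ≤ C(Σc_j, Σe_j)`, induction on `J` from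
`Nat.add_choose_eq`, or the injection "union of the chosen sub-blocks"); and when `m ≤ |s|`,
`F ≥ e^{κ₁ b}` by `hU` (`N := |s| ≤ n`).  Case `|s| < m`: the κ-free inequality
`rows·cols ≤ |s|!·cells` (same induction with `F ≥ 1`) and `exp(κ₁(|s|-m)) ≤ 1`.  Case `m ≤ |s|`:
`e^{κ₁(|s|-m)} = e^{κ₁ b}·e^{κ₁(|s'|-m)}` and the induction hypothesis for `s'`.  Why it might
fail: it cannot (finite bookkeeping); the risk is Lean size only.
[BCCGU17 arXiv:1712.02302 §4 (double cosets of Young subgroups); Mathlib `Nat.add_choose_eq`,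
`Finset.card_eq_sum_card_fiberwise`, `Finset.prod_image`, `Finset.strongInduction`] -/
-- LANDED p97130: Theorems/SnSubsetDichotomyGlobalBranchStubSqueezeInduction.lean (`Theorems.GlobalBranch.stub_squeezeInduction`).
theorem stub_squeezeInduction (n : ℕ) (B m κ₁ : ℝ) (hm : 0 ≤ m) (hκ₁ : 0 ≤ κ₁)
    (hU : ∀ (J : Finset ℕ) (c e : ℕ → ℕ) (N b : ℕ), m ≤ (N : ℝ) → N ≤ n →
      (∑ j ∈ J, c j) = N → (∑ j ∈ J, e j) = b → ((b : ℕ) : ℝ) ≤ B →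
      (∀ j ∈ J, ((c j : ℕ) : ℝ) ≤ B) →
      ((∏ j ∈ J, (c j).choose (e j) : ℕ) : ℝ) ≤ Real.exp (-(κ₁ * (b : ℝ))) * ((N.choose b : ℕ) : ℝ))
    (s : Finset (Fin n)) (f g : Fin n → ℕ)
    (hf : ∀ i, (((s.filter (fun p => f p = i)).card : ℕ) : ℝ) ≤ B)
    (hg : ∀ j, (((s.filter (fun p => g p = j)).card : ℕ) : ℝ) ≤ B) :
    ((∏ i ∈ s.image f, ((s.filter (fun p => f p = i)).card).factorial : ℕ) : ℝ) *
        ((∏ j ∈ s.image g, ((s.filter (fun p => g p = j)).card).factorial : ℕ) : ℝ) *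
        Real.exp (κ₁ * ((s.card : ℝ) - m)) ≤
      ((s.card).factorial : ℝ) *
        ((∏ q ∈ s.image (fun p => (f p, g p)),
            ((s.filter (fun p => (f p, g p) = q)).card).factorial : ℕ) : ℝ) :=
  Summit.MatrixMultiplication.MatrixMultiplication.Theorems.GlobalBranch.stub_squeezeInduction n B m κ₁ hm
    hκ₁ hU s f g hf hg

/-- **The multinomial squeeze** (card `DoubleCosetSqueeze`, fineness cap `1/2 ≤ θ < 2/3`,
`κ = 1/32`; PROVED from stubs 2a + 2b).  For two labellings `f g` of `Fin n` all of whose blocks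
have size `≤ n^θ`: `∏_rows bᵢ! · ∏_cols cⱼ! ≤ n! · exp(-n^{2-2θ}/32) · ∏_cells e_q!` for
`n ≥ n₁(θ)` — every double coset of two such Young subgroups has `|Y_f x Y_g| ≤ n!·e^{-n^{2-2θ}/32}`. -/
theorem multinomialSqueeze : ∀ θ : ℝ, 1 / 2 ≤ θ → θ < 2 / 3 → ∃ κ : ℝ, 0 < κ ∧ ∃ n₁ : ℕ,
    ∀ n ≥ n₁, ∀ f g : Fin n → ℕ,
    (∀ i, (((univ.filter (fun p => f p = i)).card : ℕ) : ℝ) ≤ (n : ℝ) ^ θ) →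
    (∀ j, (((univ.filter (fun p => g p = j)).card : ℕ) : ℝ) ≤ (n : ℝ) ^ θ) →
    ((∏ i ∈ univ.image f, ((univ.filter (fun p => f p = i)).card).factorial : ℕ) : ℝ) *
        ((∏ j ∈ univ.image g, ((univ.filter (fun p => g p = j)).card).factorial : ℕ) : ℝ) ≤
      (n.factorial : ℝ) * Real.exp (-(κ * (n : ℝ) ^ (2 - 2 * θ))) *
        ((∏ q ∈ univ.image (fun p => (f p, g p)),
            ((univ.filter (fun p => (f p, g p) = q)).card).factorial : ℕ) : ℝ) := by
  intro θ hθ hθ'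
  obtain ⟨n₁, hurn⟩ := stub_urnBound θ hθ hθ'
  refine ⟨1 / 32, by norm_num, max n₁ 1, ?_⟩
  intro n hn f g hf hg
  have hn₁ : n₁ ≤ n := le_trans (le_max_left _ _) hn
  have hn1 : 1 ≤ n := le_trans (le_max_right _ _) hn
  have hnpos : (0 : ℝ) < (n : ℝ) := by exact_mod_cast hn1
  -- the row-peeling induction on `s = univ`, fed with the urn bound at `B = n^θ`, `m = n/2`,
  -- `κ₁ = n^{1-2θ}/16`
  have hκ₁ : (0 : ℝ) ≤ (n : ℝ) ^ (1 - 2 * θ) / 16 := by positivity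
  have hind := stub_squeezeInduction n ((n : ℝ) ^ θ) ((n : ℝ) / 2) ((n : ℝ) ^ (1 - 2 * θ) / 16)
    (by positivity) hκ₁ (fun J c e N b h1 h2 h3 h4 h5 h6 => hurn n hn₁ J c e N b h1 h2 h3 h4 h5 h6)
    univ f g hf hg
  rw [Finset.card_univ, Fintype.card_fin] at hind
  -- κ₁ (n - n/2) = n^{2-2θ}/32
  have hexp : (n : ℝ) ^ (1 - 2 * θ) / 16 * ((n : ℝ) - (n : ℝ) / 2) =
      1 / 32 * (n : ℝ) ^ (2 - 2 * θ) := by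
    have h2 : (n : ℝ) ^ (2 - 2 * θ) = (n : ℝ) ^ (1 - 2 * θ) * (n : ℝ) := by
      rw [show (2 - 2 * θ) = (1 - 2 * θ) + 1 by ring, Real.rpow_add_one hnpos.ne']
    rw [h2]; ring
  rw [hexp] at hind
  -- rearrange: R·C·e^{κ m} ≤ n!·E  ⇒  R·C ≤ n!·e^{-κ m}·E
  set R : ℝ := ((∏ i ∈ univ.image f, ((univ.filter (fun p => f p = i)).card).factorial : ℕ) : ℝ)
  set C : ℝ := ((∏ j ∈ univ.image g, ((univ.filter (fun p => g p = j)).card).factorial : ℕ) : ℝ)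
  set E : ℝ := ((∏ q ∈ univ.image (fun p => (f p, g p)),
            ((univ.filter (fun p => (f p, g p) = q)).card).factorial : ℕ) : ℝ)
  have hE : Real.exp (-(1 / 32 * (n : ℝ) ^ (2 - 2 * θ))) *
      Real.exp (1 / 32 * (n : ℝ) ^ (2 - 2 * θ)) = 1 := by
    rw [← Real.exp_add]; simp
  calc R * C = R * C * Real.exp (1 / 32 * (n : ℝ) ^ (2 - 2 * θ)) *
        Real.exp (-(1 / 32 * (n : ℝ) ^ (2 - 2 * θ))) := by
          rw [mul_assoc (R * C), mul_comm (Real.exp _), hE, mul_one]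
    _ ≤ (n.factorial : ℝ) * E * Real.exp (-(1 / 32 * (n : ℝ) ^ (2 - 2 * θ))) := by
          gcongr
    _ = (n.factorial : ℝ) * Real.exp (-(1 / 32 * (n : ℝ) ^ (2 - 2 * θ))) * E := by ring

/-! ## The incoherent case (LANDED p97272 as `Theorems/SnSubsetDichotomyGlobalBranchIncoherentCase.lean`, from the flat-tail theorems `stub_truncatedCount` + `stub_dimGrowth`) -/

section Incoherent

variable {n : ℕ}

/-- Spectral level-`ℓ` mass of `X ⊆ 𝔖ₙ` on the first-ROW family (`μ ≠ (n)`, `μ₁ = n - ℓ`):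
`|X|⁻² Σ_μ Σ_{x,y∈X} Re χ^μ(x⁻¹y)` (vocabulary of the landed flat-tail theorems). -/
def specMass (ℓ : ℕ) (X : Finset (Equiv.Perm (Fin n))) : ℝ :=
  (∑ μ ∈ univ.filter (fun μ : Nat.Partition n =>
      μ ≠ Nat.Partition.indiscrete n ∧ μ.parts.sup = n - ℓ),
    ∑ x ∈ X, ∑ y ∈ X, (spechtCharacter ℂ μ (x⁻¹ * y)).re) / ((X.card : ℝ) ^ 2)

/-- Spectral level-`ℓ` mass on the first-COLUMN family (`μ ≠ (n)`, `μ₁' = n - ℓ`). -/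
def specMassT (ℓ : ℕ) (X : Finset (Equiv.Perm (Fin n))) : ℝ :=
  (∑ μ ∈ univ.filter (fun μ : Nat.Partition n =>
      μ ≠ Nat.Partition.indiscrete n ∧ Multiset.card μ.parts = n - ℓ),
    ∑ x ∈ X, ∑ y ∈ X, (spechtCharacter ℂ μ (x⁻¹ * y)).re) / ((X.card : ℝ) ^ 2)

/-- The **low-level coherence weight** of a triple up to level `L`:
`Σ_{ℓ=1}^{L} n^{(ℓ)}·(sM ℓ S·sM ℓ T·sM ℓ U + sT ℓ S·sT ℓ T·sT ℓ U)`. -/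
def lowWeight (L : ℕ) (S T U : Finset (Equiv.Perm (Fin n))) : ℝ :=
  ∑ ℓ ∈ Finset.Ico 1 (L + 1), (n.descFactorial ℓ : ℝ) *
    (specMass ℓ S * specMass ℓ T * specMass ℓ U + specMassT ℓ S * specMassT ℓ T * specMassT ℓ U)

/-- **The incoherent case of `GlobalBranch`** (PROVED, from the landed truncated count
`Theorems.GlobalBranch.stub_truncatedCount` and dimension growth `Theorems.GlobalBranch.stub_dimGrowth`
of the line `flat-tail-truncation`): for some absolute `c > 0` and all large `n`, every TPP triple in
`𝔖ₙ` whose low-level coherence weight `lowWeight ⌊√n⌋ S T U` is at most `1/2` has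
`|S||T||U| ≤ (n!)^{3/2} e^{-c√n}`.  (The flat case of that line is the special case where every set is
flat at every level; here only the TRIPLE products of the spectral masses are asked to be small.) -/
theorem incoherent_subthreshold :
    ∃ c : ℝ, 0 < c ∧ ∃ n₂ : ℕ, ∀ n ≥ n₂, ∀ S T U : Finset (Equiv.Perm (Fin n)),
      TripleProductProperty S T U → lowWeight (Nat.sqrt n) S T U ≤ 1 / 2 →
      ((S.card * T.card * U.card : ℕ) : ℝ) ≤
        (n.factorial : ℝ) ^ ((3 : ℝ) / 2) * Real.exp (-(c * Real.sqrt (n : ℝ))) := by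
  obtain ⟨c, hc, n₂, h⟩ :=
    Summit.MatrixMultiplication.MatrixMultiplication.Theorems.GlobalBranch.incoherent_subthreshold
  exact ⟨c, hc, n₂, fun n hn S T U hTPP hΛ =>
    h n hn specMass specMassT (fun _ _ => rfl) (fun _ _ => rfl) S T U hTPP hΛ⟩

end Incoherent

/-! ## Stub 3 — the residue: COHERENT bump-free triples with two fine-Young-evasive sets (size XL; hardest) -/

/-- **Coherent evasive residual** (the crux restricted to the class neither pre-filter sees;
HARDEST stub, crux-sized and open — a NAMED target).  A set `X ⊆ S_n` is `(θ,κ)`-fine-Young-EVASIVE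
when every two-sided coset `a·Y_f·b` of a Young subgroup all of whose blocks are `≤ n^θ` captures at
most `exp(-κ n^{2-2θ})·|X|` of it; a triple is spectrally COHERENT when its low-level weight
`Σ_{ℓ=1}^{⌊√n⌋} n^{(ℓ)}(sM ℓ S·sM ℓ T·sM ℓ U + sT ℓ S·sT ℓ T·sT ℓ U)` exceeds `1/2`, where `sM ℓ X`
(`sT ℓ X`) is the Hilbert–Schmidt mass `|X|⁻² Σ_μ Σ_{x,y∈X} Re χ^μ(x⁻¹y)` of `1̂_X` on the
irreducibles with first row (first column) `n - ℓ` (pinned function parameters, as in the landed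
`Theorems.GlobalBranch.stub_flatCase`).  Claim: for some bump exponent `ε > 0`, some fineness cap
`1/2 ≤ θ < 2/3` (both the prover's choice) and EVERY `κ > 0` there are `c > 0, n₀` such that every
TPP triple in `S_n`, `n ≥ n₀`, which is bump-free at exponent `1/2+ε` up to level `√n` (the crux's
hypothesis, verbatim), has at least two `(θ,κ)`-evasive sets AND is spectrally coherent has
`|S||T||U| ≤ (n!)^{3/2} e^{-c√n}`.  What it has shed: every triple with two sets fractionally hosted
by fine Young cosets (the planar/hexagon families of `not_globalBranchSuperExp` and all their
sub-codes, up to blocks `n^{2/3-η}`: `twoCaptured_subthreshold`) and every incoherent triple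
(`incoherent_subthreshold`, in particular every triple with a spectrally flat set at each level, the
flat case of flat-tail-truncation).  What it keeps (why it is crux-sized): dense random-like subsets
of three matching centralisers `B(Mᵢ) = S₂ ≀ S_{n/2}` (bump-free, `n^{-Ω(n)}`-evasive, `sM 2 ≍ 1`
each so `lowWeight ≥ n^{(2)}·Ω(1) ≫ 1/2`) — the bump-free core of crux `HyperoctahedralSubsets`
(stmt-8305); transversal designs; giant-block hosts.  Why it might fail: it is `GlobalBranch` on
that class — an unrooted bump-neutral threshold triple inside three `B(Mᵢ)` refutes it (and then
proves `ω = 2` via `closes`, Disproof §1); no inverse theorem at density `(n!)^{-1/2}` is known.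
[BCCGU17 arXiv:1712.02302 §4–5; BCGPU23 arXiv:2204.03826 Thm 3.2; KeevashLifshitz2023
arXiv:2307.15030; KLM22 arXiv:2205.15191] -/
theorem stub_coherentEvasiveResidual : ∃ ε : ℝ, 0 < ε ∧ ∃ θ : ℝ, 1 / 2 ≤ θ ∧ θ < 2 / 3 ∧
    ∀ κ : ℝ, 0 < κ → ∃ c : ℝ, 0 < c ∧ ∃ n₀ : ℕ, ∀ n ≥ n₀,
    ∀ (sM sT : ℕ → Finset (Equiv.Perm (Fin n)) → ℝ),
    (∀ (ℓ : ℕ) (X : Finset (Equiv.Perm (Fin n))), sM ℓ X =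
      (∑ μ ∈ univ.filter (fun μ : Nat.Partition n =>
          μ ≠ Nat.Partition.indiscrete n ∧ μ.parts.sup = n - ℓ),
        ∑ x ∈ X, ∑ y ∈ X, (spechtCharacter ℂ μ (x⁻¹ * y)).re) / ((X.card : ℝ) ^ 2)) →
    (∀ (ℓ : ℕ) (X : Finset (Equiv.Perm (Fin n))), sT ℓ X =
      (∑ μ ∈ univ.filter (fun μ : Nat.Partition n =>
          μ ≠ Nat.Partition.indiscrete n ∧ Multiset.card μ.parts = n - ℓ),
        ∑ x ∈ X, ∑ y ∈ X, (spechtCharacter ℂ μ (x⁻¹ * y)).re) / ((X.card : ℝ) ^ 2)) →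
    ∀ S T U : Finset (Equiv.Perm (Fin n)), TripleProductProperty S T U →
    (∀ X : Finset (Equiv.Perm (Fin n)), (X = S ∨ X = T ∨ X = U) → ∀ t : ℕ, 1 ≤ t →
      (t : ℝ) ≤ Real.sqrt (n : ℝ) → ∀ I L : Fin t → Fin n, Function.Injective I →
      Function.Injective L →
      ((X.filter (fun σ => ∀ k, σ (I k) = L k)).card : ℝ) * (n.descFactorial t : ℝ) ≤
        (n : ℝ) ^ ((1 / 2 + ε) * t) * (X.card : ℝ)) →
    (∃ X₁ X₂ : Finset (Equiv.Perm (Fin n)),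
      ((X₁ = S ∧ X₂ = T) ∨ (X₁ = T ∧ X₂ = U) ∨ (X₁ = S ∧ X₂ = U)) ∧
      (∀ f : Fin n → ℕ,
        (∀ i, (((univ.filter (fun p => f p = i)).card : ℕ) : ℝ) ≤ (n : ℝ) ^ θ) →
        ∀ a b : Equiv.Perm (Fin n),
          (((X₁.filter (fun σ => a⁻¹ * σ * b⁻¹ ∈ youngSubgroup f)).card : ℕ) : ℝ) ≤
            Real.exp (-(κ * (n : ℝ) ^ (2 - 2 * θ))) * (X₁.card : ℝ)) ∧
      (∀ f : Fin n → ℕ,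
        (∀ i, (((univ.filter (fun p => f p = i)).card : ℕ) : ℝ) ≤ (n : ℝ) ^ θ) →
        ∀ a b : Equiv.Perm (Fin n),
          (((X₂.filter (fun σ => a⁻¹ * σ * b⁻¹ ∈ youngSubgroup f)).card : ℕ) : ℝ) ≤
            Real.exp (-(κ * (n : ℝ) ^ (2 - 2 * θ))) * (X₂.card : ℝ))) →
    (1 / 2 < ∑ ℓ ∈ Finset.Ico 1 (Nat.sqrt n + 1), (n.descFactorial ℓ : ℝ) *
      (sM ℓ S * sM ℓ T * sM ℓ U + sT ℓ S * sT ℓ T * sT ℓ U)) →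
    ((S.card * T.card * U.card : ℕ) : ℝ) ≤
      (n.factorial : ℝ) ^ ((3 : ℝ) / 2) * Real.exp (-(c * Real.sqrt (n : ℝ))) := by
  sorry

/-! ## Glue (sorry-free): the squeeze for a captured pair, the dichotomy, the crux by name -/

/-- Fineness of a labelling at cap `θ`: all blocks `≤ n^θ` (local abbreviation; the stubs unfold it). -/
def Fine {n : ℕ} (θ : ℝ) (f : Fin n → ℕ) : Prop :=
  ∀ i, (((univ.filter (fun p => f p = i)).card : ℕ) : ℝ) ≤ (n : ℝ) ^ θ

/-- `(θ,κ)`-fine-Young-evasiveness of `X` (local abbreviation; the stubs unfold it). -/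
def Evasive {n : ℕ} (θ κ : ℝ) (X : Finset (Equiv.Perm (Fin n))) : Prop :=
  ∀ f : Fin n → ℕ, Fine θ f → ∀ a b : Equiv.Perm (Fin n),
    (((X.filter (fun σ => a⁻¹ * σ * b⁻¹ ∈ youngSubgroup f)).card : ℕ) : ℝ) ≤
      Real.exp (-(κ * (n : ℝ) ^ (2 - 2 * θ))) * (X.card : ℝ)

/-- Fineness is invariant under relabelling the points by a permutation. -/
theorem fine_comp {n : ℕ} {θ : ℝ} {g : Fin n → ℕ} (hg : Fine θ g) (y : Equiv.Perm (Fin n)) :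
    Fine θ (fun p => g (y p)) := by
  intro j
  have hc : (univ.filter (fun p => g (y p) = j)).card = (univ.filter (fun q => g q = j)).card := by
    refine Finset.card_equiv y ?_
    intro p
    simp
  rw [hc]
  exact hg j

/-- Real bookkeeping 1: cancel the (positive) cell product. -/
theorem core_cancel {x y P R C B : ℝ} (h1 : x * y * P ≤ R * C) (h2 : R * C ≤ B * P)
    (hP : 0 < P) : x * y ≤ B :=
  le_of_mul_le_mul_right (h1.trans h2) hP

/-- Real bookkeeping 2: two captures of strength `δ = e^{-(κ/4)m}` against `x·y ≤ F e^{-κ m}`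
give `a·b ≤ F e^{-(κ/2) m}`. -/
theorem core_capture {δ a b x y F κ m : ℝ} (hδ : δ = Real.exp (-(κ / 4 * m)))
    (hA : δ * a < x) (hB : δ * b < y) (h3 : x * y ≤ F * Real.exp (-(κ * m)))
    (ha : 0 ≤ a) (hb : 0 ≤ b) (hF : 0 ≤ F) :
    a * b ≤ F * Real.exp (-(κ / 2 * m)) := by
  have hδ0 : 0 < δ := by rw [hδ]; exact Real.exp_pos _
  have hE4 : Real.exp (-(κ * m)) = δ ^ 4 := by
    rw [hδ, ← Real.exp_nat_mul]; congr 1; push_cast; ring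
  have hE2 : Real.exp (-(κ / 2 * m)) = δ ^ 2 := by
    rw [hδ, ← Real.exp_nat_mul]; congr 1; push_cast; ring
  have hx : 0 ≤ x := le_of_lt (lt_of_le_of_lt (by positivity) hA)
  have hxy : δ * a * (δ * b) ≤ x * y := mul_le_mul hA.le hB.le (by positivity) hx
  have h5 : δ ^ 2 * (a * b) ≤ δ ^ 2 * (F * Real.exp (-(κ / 2 * m))) := by
    calc δ ^ 2 * (a * b) = δ * a * (δ * b) := by ring
      _ ≤ x * y := hxy
      _ ≤ F * Real.exp (-(κ * m)) := h3
      _ = δ ^ 2 * (F * Real.exp (-(κ / 2 * m))) := by rw [hE4, hE2]; ring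
  exact le_of_mul_le_mul_left h5 (by positivity)

/-- Real bookkeeping 3: from the squared volume bound to the `(n!)^{3/2}` form. -/
theorem vol_le_of_sq {v F E₁ E₂ : ℝ} (hF : 0 < F) (hE₂ : 0 ≤ E₂)
    (hv : v ^ 2 ≤ F * E₁ * (F * F)) (hE : E₁ ≤ E₂ ^ 2) :
    v ≤ F ^ ((3 : ℝ) / 2) * E₂ := by
  have h3 : (F ^ ((3 : ℝ) / 2)) ^ 2 = F ^ 3 := by
    rw [← Real.rpow_mul_natCast hF.le, show ((3 : ℝ) / 2 * (2 : ℕ)) = ((3 : ℕ) : ℝ) by norm_num,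
      Real.rpow_natCast]
  have h4 : v ^ 2 ≤ (F ^ ((3 : ℝ) / 2) * E₂) ^ 2 := by
    calc v ^ 2 ≤ F * E₁ * (F * F) := hv
      _ = F ^ 3 * E₁ := by ring
      _ ≤ F ^ 3 * E₂ ^ 2 := by gcongr
      _ = (F ^ ((3 : ℝ) / 2) * E₂) ^ 2 := by rw [mul_pow, h3]
  exact le_of_pow_le_pow_left₀ two_ne_zero (by positivity) h4

/-- THE SQUEEZE FOR A CAPTURED PAIR (card, local form (4); proved from stubs 1 + 2): if `A, B`
have the pairwise TPP, pack against a third set `W` (`|A||W|, |B||W| ≤ n!`), and each is captured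
to a fraction `> exp(-(κ/4) n^{2-2θ})` by some Young coset with blocks `≤ n^θ` (`θ < 3/4`),
then `|A||B||W| ≤ (n!)^{3/2} exp(-(κ/4)√n)`. -/
theorem pair_subthreshold {n : ℕ} {θ κ : ℝ} (hθ : θ < 3 / 4) (hκ : 0 < κ) (hn : 1 ≤ n)
    (hsq : ∀ f g : Fin n → ℕ, Fine θ f → Fine θ g →
      ((∏ i ∈ univ.image f, ((univ.filter (fun p => f p = i)).card).factorial : ℕ) : ℝ) *
        ((∏ j ∈ univ.image g, ((univ.filter (fun p => g p = j)).card).factorial : ℕ) : ℝ) ≤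
      (n.factorial : ℝ) * Real.exp (-(κ * (n : ℝ) ^ (2 - 2 * θ))) *
        ((∏ q ∈ univ.image (fun p => (f p, g p)),
            ((univ.filter (fun p => (f p, g p) = q)).card).factorial : ℕ) : ℝ))
    (A B W : Finset (Equiv.Perm (Fin n)))
    (hAB : ∀ s ∈ A, ∀ s' ∈ A, ∀ t ∈ B, ∀ t' ∈ B, s * s'⁻¹ * (t * t'⁻¹) = 1 → s = s' ∧ t = t')
    (hAW : A.card * W.card ≤ n.factorial) (hBW : B.card * W.card ≤ n.factorial)
    (hA : ¬ Evasive θ (κ / 4) A) (hB : ¬ Evasive θ (κ / 4) B) :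
    (A.card : ℝ) * B.card * W.card ≤
      (n.factorial : ℝ) ^ ((3 : ℝ) / 2) * Real.exp (-(κ / 4 * Real.sqrt (n : ℝ))) := by
  -- unpack the two captures
  simp only [Evasive, not_forall, not_le, exists_prop] at hA hB
  obtain ⟨f, hf, a, b, hA⟩ := hA
  obtain ⟨g, hg, a', b', hB⟩ := hB
  have hF0 : (0 : ℝ) < (n.factorial : ℝ) := by exact_mod_cast n.factorial_pos
  -- the relabelled column labelling is fine
  have hg' : Fine θ (fun p => g ((a'⁻¹ * a) p)) := fine_comp hg (a'⁻¹ * a)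
  -- stub 1 (in ℕ, cast to ℝ) and stub 2 at (f, g ∘ (a'⁻¹a))
  have h1 := stub_hostedPairCount A B f g a b a' b' hAB
  have h1r := (Nat.cast_le (α := ℝ)).mpr h1
  simp only [Nat.cast_mul] at h1r
  have h2 := hsq f (fun p => g ((a'⁻¹ * a) p)) hf hg'
  -- cancel the cell product: cA·cB ≤ n!·e^{-κ m}
  have h3 := core_cancel h1r h2 (by positivity)
  -- the two captures: |A||B| ≤ n!·e^{-(κ/2) m}
  have h4 : (A.card : ℝ) * B.card ≤
      (n.factorial : ℝ) * Real.exp (-(κ / 2 * (n : ℝ) ^ (2 - 2 * θ))) :=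
    core_capture rfl hA hB h3 (by positivity) (by positivity) hF0.le
  -- square the volume and use the two packing bounds
  have hAWr : (A.card : ℝ) * W.card ≤ (n.factorial : ℝ) := by exact_mod_cast hAW
  have hBWr : (B.card : ℝ) * W.card ≤ (n.factorial : ℝ) := by exact_mod_cast hBW
  have hv : ((A.card : ℝ) * B.card * W.card) ^ 2 ≤
      (n.factorial : ℝ) * Real.exp (-(κ / 2 * (n : ℝ) ^ (2 - 2 * θ))) *
        ((n.factorial : ℝ) * (n.factorial : ℝ)) := by
    calc ((A.card : ℝ) * B.card * W.card) ^ 2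
          = ((A.card : ℝ) * B.card) * (((A.card : ℝ) * W.card) * ((B.card : ℝ) * W.card)) := by
            ring
      _ ≤ (n.factorial : ℝ) * Real.exp (-(κ / 2 * (n : ℝ) ^ (2 - 2 * θ))) *
            ((n.factorial : ℝ) * (n.factorial : ℝ)) := by gcongr
  -- √n ≤ n^{2-2θ} (θ < 3/4), hence e^{-(κ/2) m} ≤ (e^{-(κ/4)√n})²
  have hn1 : (1 : ℝ) ≤ (n : ℝ) := by exact_mod_cast hn
  have hsqrt_le : Real.sqrt (n : ℝ) ≤ (n : ℝ) ^ (2 - 2 * θ) := by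
    rw [Real.sqrt_eq_rpow]
    exact Real.rpow_le_rpow_of_exponent_le hn1 (by linarith)
  have hE : Real.exp (-(κ / 2 * (n : ℝ) ^ (2 - 2 * θ))) ≤
      (Real.exp (-(κ / 4 * Real.sqrt (n : ℝ)))) ^ 2 := by
    rw [← Real.exp_nat_mul, Real.exp_le_exp]
    push_cast
    nlinarith
  exact vol_le_of_sq hF0 (Real.exp_pos _).le hv hE

/-- From the TPP: the pairwise part for `(S,T)` (needs `U` non-empty). -/
theorem pairTPP_of_tpp {n : ℕ} {S T U : Finset (Equiv.Perm (Fin n))}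
    (h : TripleProductProperty S T U) (hU : U.Nonempty) :
    ∀ s ∈ S, ∀ s' ∈ S, ∀ t ∈ T, ∀ t' ∈ T, s * s'⁻¹ * (t * t'⁻¹) = 1 → s = s' ∧ t = t' := by
  obtain ⟨u, hu⟩ := hU
  intro s hs s' hs' t ht t' ht' heq
  have key : s * s'⁻¹ * (t * t'⁻¹) * (u * u⁻¹) = 1 := by rw [mul_inv_cancel, mul_one, heq]
  obtain ⟨h1, h2, -⟩ := h s hs s' hs' t ht t' ht' u hu u hu key
  exact ⟨h1, h2⟩

/-- TWO CAPTURED SETS ARE SUB-THRESHOLD (the class-pruning theorem of the line, proved from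
stubs 1 + 2): a TPP triple in `S_n`, `n ≥ 1` in the squeeze range, in which some two of
`S, T, U` are NOT `(θ, κ/4)`-evasive has `|S||T||U| ≤ (n!)^{3/2} exp(-(κ/4)√n)`. -/
theorem twoCaptured_subthreshold {n : ℕ} {θ κ : ℝ} (hθ : θ < 3 / 4) (hκ : 0 < κ) (hn : 1 ≤ n)
    (hsq : ∀ f g : Fin n → ℕ, Fine θ f → Fine θ g →
      ((∏ i ∈ univ.image f, ((univ.filter (fun p => f p = i)).card).factorial : ℕ) : ℝ) *
        ((∏ j ∈ univ.image g, ((univ.filter (fun p => g p = j)).card).factorial : ℕ) : ℝ) ≤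
      (n.factorial : ℝ) * Real.exp (-(κ * (n : ℝ) ^ (2 - 2 * θ))) *
        ((∏ q ∈ univ.image (fun p => (f p, g p)),
            ((univ.filter (fun p => (f p, g p) = q)).card).factorial : ℕ) : ℝ))
    (S T U : Finset (Equiv.Perm (Fin n))) (htpp : TripleProductProperty S T U)
    (h2 : (¬ Evasive θ (κ / 4) S ∧ ¬ Evasive θ (κ / 4) T) ∨
      (¬ Evasive θ (κ / 4) T ∧ ¬ Evasive θ (κ / 4) U) ∨
      (¬ Evasive θ (κ / 4) S ∧ ¬ Evasive θ (κ / 4) U)) :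
    ((S.card * T.card * U.card : ℕ) : ℝ) ≤
      (n.factorial : ℝ) ^ ((3 : ℝ) / 2) * Real.exp (-(κ / 4 * Real.sqrt (n : ℝ))) := by
  -- an empty set gives volume 0
  by_cases hS : S = ∅
  · subst hS; simp only [Finset.card_empty, zero_mul, Nat.cast_zero]; positivity
  by_cases hT : T = ∅
  · subst hT; simp only [Finset.card_empty, zero_mul, mul_zero, Nat.cast_zero]; positivity
  by_cases hU : U = ∅
  · subst hU; simp only [Finset.card_empty, mul_zero, Nat.cast_zero]; positivity
  have hSn : S.Nonempty := Finset.nonempty_iff_ne_empty.2 hS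
  have hTn : T.Nonempty := Finset.nonempty_iff_ne_empty.2 hT
  have hUn : U.Nonempty := Finset.nonempty_iff_ne_empty.2 hU
  -- packing |S||T|, |T||U|, |U||S| ≤ n! (tree: `tpp_card_mul_card_le_three`)
  obtain ⟨hST, hTU, hUS⟩ := tpp_card_mul_card_le_three htpp hSn hTn hUn
  have hcard : Fintype.card (Equiv.Perm (Fin n)) = n.factorial := by
    rw [Fintype.card_perm, Fintype.card_fin]
  rw [hcard] at hST hTU hUS
  have hTS : T.card * S.card ≤ n.factorial := by simpa [mul_comm] using hST
  have hSU : S.card * U.card ≤ n.factorial := by simpa [mul_comm] using hUS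
  have hUT : U.card * T.card ≤ n.factorial := by simpa [mul_comm] using hTU
  push_cast
  rcases h2 with ⟨hS', hT'⟩ | ⟨hT', hU'⟩ | ⟨hS', hU'⟩
  · -- pair (S,T), third set U
    exact pair_subthreshold hθ hκ hn hsq S T U (pairTPP_of_tpp htpp hUn) hSU hTU hS' hT'
  · -- pair (T,U), third set S
    have h := pair_subthreshold hθ hκ hn hsq T U S (pairTPP_of_tpp htpp.rotate hSn) hTS hUS hT' hU'
    calc (S.card : ℝ) * T.card * U.card = (T.card : ℝ) * U.card * S.card := by ring
      _ ≤ _ := h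
  · -- pair (U,S), third set T
    have h := pair_subthreshold hθ hκ hn hsq U S T (pairTPP_of_tpp htpp.rotate.rotate hTn) hUT
      hST hU' hS'
    calc (S.card : ℝ) * T.card * U.card = (U.card : ℝ) * S.card * T.card := by ring
      _ ≤ _ := h

/-- **The skeleton theorem**: the four stubs imply the crux `GlobalBranch` BY NAME.
Take `ε, θ` from the residual stub, `κ(θ), n₁` from the squeeze (stubs 2a + 2b via
`multinomialSqueeze`), `c_inc, n₂` from the incoherent case; invoke the residual at evasiveness
parameter `κ/4` (giving `c_res, n_res`); the crux holds with this `ε`,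
`c := min (min c_res (κ/4)) c_inc` and `n₀ := max (max n_res n₂) (max n₁ 1)`: a bump-free TPP triple
is incoherent (`incoherent_subthreshold`), or coherent with two `(θ,κ/4)`-evasive sets (residual), or,
by pigeonhole on three sets, has two captured ones (`twoCaptured_subthreshold`). -/
theorem GlobalBranch_of : GlobalBranch := by
  obtain ⟨ε, hε, θ, hθ, hθ', hres⟩ := stub_coherentEvasiveResidual
  obtain ⟨κ, hκ, n₁, hsq⟩ := multinomialSqueeze θ hθ hθ'
  obtain ⟨ci, hci, n₂, hinc⟩ := incoherent_subthreshold
  have hθ'' : θ < 3 / 4 := by linarith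
  obtain ⟨c, hc, n₀, hres⟩ := hres (κ / 4) (by positivity)
  refine ⟨ε, hε, min (min c (κ / 4)) ci, lt_min (lt_min hc (by positivity)) hci,
    max (max n₀ n₂) (max n₁ 1), ?_⟩
  intro n hn S T U htpp hbf
  have hn₀ : n₀ ≤ n := le_trans (le_trans (le_max_left _ _) (le_max_left _ _)) hn
  have hn₂ : n₂ ≤ n := le_trans (le_trans (le_max_right _ _) (le_max_left _ _)) hn
  have hn₁ : n₁ ≤ n := le_trans (le_trans (le_max_left _ _) (le_max_right _ _)) hn
  have hn1 : 1 ≤ n := le_trans (le_trans (le_max_right _ _) (le_max_right _ _)) hn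
  -- monotonicity of the threshold in the constant
  have hmono : ∀ c' : ℝ, min (min c (κ / 4)) ci ≤ c' →
      (n.factorial : ℝ) ^ ((3 : ℝ) / 2) * Real.exp (-(c' * Real.sqrt (n : ℝ))) ≤
        (n.factorial : ℝ) ^ ((3 : ℝ) / 2) *
          Real.exp (-(min (min c (κ / 4)) ci * Real.sqrt (n : ℝ))) := by
    intro c' hc'
    have hs : 0 ≤ Real.sqrt (n : ℝ) := Real.sqrt_nonneg _
    have : min (min c (κ / 4)) ci * Real.sqrt (n : ℝ) ≤ c' * Real.sqrt (n : ℝ) :=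
      mul_le_mul_of_nonneg_right hc' hs
    gcongr
  by_cases hcoh : lowWeight (Nat.sqrt n) S T U ≤ 1 / 2
  · -- incoherent triples are sub-threshold (flat-tail machinery)
    exact (hinc n hn₂ S T U htpp hcoh).trans (hmono ci (min_le_right _ _))
  have hcoh' : 1 / 2 < ∑ ℓ ∈ Finset.Ico 1 (Nat.sqrt n + 1), (n.descFactorial ℓ : ℝ) *
      (specMass ℓ S * specMass ℓ T * specMass ℓ U +
        specMassT ℓ S * specMassT ℓ T * specMassT ℓ U) := not_le.mp hcoh
  by_cases hE : (Evasive θ (κ / 4) S ∧ Evasive θ (κ / 4) T) ∨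
      (Evasive θ (κ / 4) T ∧ Evasive θ (κ / 4) U) ∨ (Evasive θ (κ / 4) S ∧ Evasive θ (κ / 4) U)
  · -- coherent with two evasive sets: the residual stub
    have hE' : ∃ X₁ X₂ : Finset (Equiv.Perm (Fin n)),
        ((X₁ = S ∧ X₂ = T) ∨ (X₁ = T ∧ X₂ = U) ∨ (X₁ = S ∧ X₂ = U)) ∧
        Evasive θ (κ / 4) X₁ ∧ Evasive θ (κ / 4) X₂ := by
      rcases hE with ⟨h1, h2⟩ | ⟨h1, h2⟩ | ⟨h1, h2⟩
      · exact ⟨S, T, Or.inl ⟨rfl, rfl⟩, h1, h2⟩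
      · exact ⟨T, U, Or.inr (Or.inl ⟨rfl, rfl⟩), h1, h2⟩
      · exact ⟨S, U, Or.inr (Or.inr ⟨rfl, rfl⟩), h1, h2⟩
    exact (hres n hn₀ specMass specMassT (fun _ _ => rfl) (fun _ _ => rfl) S T U htpp hbf hE'
      hcoh').trans (hmono c ((min_le_left _ _).trans (min_le_left _ _)))
  · -- otherwise two of the three sets are captured: the squeeze
    have h2 : (¬ Evasive θ (κ / 4) S ∧ ¬ Evasive θ (κ / 4) T) ∨
        (¬ Evasive θ (κ / 4) T ∧ ¬ Evasive θ (κ / 4) U) ∨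
        (¬ Evasive θ (κ / 4) S ∧ ¬ Evasive θ (κ / 4) U) := by
      by_cases hS : Evasive θ (κ / 4) S
      · have hT : ¬ Evasive θ (κ / 4) T := fun hT => hE (Or.inl ⟨hS, hT⟩)
        have hU : ¬ Evasive θ (κ / 4) U := fun hU => hE (Or.inr (Or.inr ⟨hS, hU⟩))
        exact Or.inr (Or.inl ⟨hT, hU⟩)
      · by_cases hT : Evasive θ (κ / 4) T
        · have hU : ¬ Evasive θ (κ / 4) U := fun hU => hE (Or.inr (Or.inl ⟨hT, hU⟩))
          exact Or.inr (Or.inr ⟨hS, hU⟩)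
        · exact Or.inl ⟨hS, hT⟩
    exact (twoCaptured_subthreshold hθ'' hκ hn1 (fun f g hf hg => hsq n hn₁ f g hf hg) S T U htpp
      h2).trans (hmono (κ / 4) ((min_le_left _ _).trans (min_le_right _ _)))

/-! ## Sanity (sorry-free): the residual stub is a genuine WEAKENING of the crux -/

/-- `stub_coherentEvasiveResidual` is implied by `GlobalBranch` (take its `ε`, `θ := 1/2`, and ignore
the evasiveness and coherence hypotheses), so it is exactly as true as the crux: by Disproof §1
(`matrixMultiplication_of_not_globalBranch`) it cannot be false unless `ω(ℂ) = 2`.  Together with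
`GlobalBranch_of` this shows the line is a faithful case split, not a strengthening. -/
theorem coherentEvasiveResidual_of_globalBranch (h : GlobalBranch) :
    ∃ ε : ℝ, 0 < ε ∧ ∃ θ : ℝ, 1 / 2 ≤ θ ∧ θ < 2 / 3 ∧
    ∀ κ : ℝ, 0 < κ → ∃ c : ℝ, 0 < c ∧ ∃ n₀ : ℕ, ∀ n ≥ n₀,
    ∀ (sM sT : ℕ → Finset (Equiv.Perm (Fin n)) → ℝ),
    (∀ (ℓ : ℕ) (X : Finset (Equiv.Perm (Fin n))), sM ℓ X =
      (∑ μ ∈ univ.filter (fun μ : Nat.Partition n =>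
          μ ≠ Nat.Partition.indiscrete n ∧ μ.parts.sup = n - ℓ),
        ∑ x ∈ X, ∑ y ∈ X, (spechtCharacter ℂ μ (x⁻¹ * y)).re) / ((X.card : ℝ) ^ 2)) →
    (∀ (ℓ : ℕ) (X : Finset (Equiv.Perm (Fin n))), sT ℓ X =
      (∑ μ ∈ univ.filter (fun μ : Nat.Partition n =>
          μ ≠ Nat.Partition.indiscrete n ∧ Multiset.card μ.parts = n - ℓ),
        ∑ x ∈ X, ∑ y ∈ X, (spechtCharacter ℂ μ (x⁻¹ * y)).re) / ((X.card : ℝ) ^ 2)) →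
    ∀ S T U : Finset (Equiv.Perm (Fin n)), TripleProductProperty S T U →
    (∀ X : Finset (Equiv.Perm (Fin n)), (X = S ∨ X = T ∨ X = U) → ∀ t : ℕ, 1 ≤ t →
      (t : ℝ) ≤ Real.sqrt (n : ℝ) → ∀ I L : Fin t → Fin n, Function.Injective I →
      Function.Injective L →
      ((X.filter (fun σ => ∀ k, σ (I k) = L k)).card : ℝ) * (n.descFactorial t : ℝ) ≤
        (n : ℝ) ^ ((1 / 2 + ε) * t) * (X.card : ℝ)) →
    (∃ X₁ X₂ : Finset (Equiv.Perm (Fin n)),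
      ((X₁ = S ∧ X₂ = T) ∨ (X₁ = T ∧ X₂ = U) ∨ (X₁ = S ∧ X₂ = U)) ∧
      (∀ f : Fin n → ℕ,
        (∀ i, (((univ.filter (fun p => f p = i)).card : ℕ) : ℝ) ≤ (n : ℝ) ^ θ) →
        ∀ a b : Equiv.Perm (Fin n),
          (((X₁.filter (fun σ => a⁻¹ * σ * b⁻¹ ∈ youngSubgroup f)).card : ℕ) : ℝ) ≤
            Real.exp (-(κ * (n : ℝ) ^ (2 - 2 * θ))) * (X₁.card : ℝ)) ∧
      (∀ f : Fin n → ℕ,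
        (∀ i, (((univ.filter (fun p => f p = i)).card : ℕ) : ℝ) ≤ (n : ℝ) ^ θ) →
        ∀ a b : Equiv.Perm (Fin n),
          (((X₂.filter (fun σ => a⁻¹ * σ * b⁻¹ ∈ youngSubgroup f)).card : ℕ) : ℝ) ≤
            Real.exp (-(κ * (n : ℝ) ^ (2 - 2 * θ))) * (X₂.card : ℝ))) →
    (1 / 2 < ∑ ℓ ∈ Finset.Ico 1 (Nat.sqrt n + 1), (n.descFactorial ℓ : ℝ) *
      (sM ℓ S * sM ℓ T * sM ℓ U + sT ℓ S * sT ℓ T * sT ℓ U)) →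
    ((S.card * T.card * U.card : ℕ) : ℝ) ≤
      (n.factorial : ℝ) ^ ((3 : ℝ) / 2) * Real.exp (-(c * Real.sqrt (n : ℝ))) := by
  obtain ⟨ε, hε, c, hc, n₀, h⟩ := h
  refine ⟨ε, hε, 1 / 2, le_rfl, by norm_num, fun κ hκ => ⟨c, hc, n₀, ?_⟩⟩
  intro n hn sM sT _hsM _hsT S T U htpp hbf _hev _hcoh
  exact h n hn S T U htpp hbf

end

end Summit.MatrixMultiplication.MatrixMultiplication.Cruxes.GlobalBranch.YoungHostSqueeze
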